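import Mathlib
import Literature.Analysis.FluidPDE.Tao2016AveragedNS.LocalCascadeSolutions
import Literature.Analysis.FluidPDE.Tao2016AveragedNS.RenormalisedCascadeWaves
import Literature.Analysis.FluidPDE.Tao2016AveragedNS.ViscousEternalSolutions
import Literature.Analysis.FluidPDE.Tao2016AveragedNS.BoundedEternalSolutions

/-!
# The sign condition `0 ≤ ν̂` of `IsEternalVisc` is LOAD-BEARING for crux K1ᵛ(1)
# `TaoLadderRungTwoBreak.NoSurvivingEternalViscBddOne` (stmt-NavierStokesRegularity-20419):
# an explicit bounded, forward (S₁)-surviving «eternal solution» with ANTI-dissipation `ν̂ = -1`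
# on the zero table, at EVERY scale ratio

MODEL lattice ODEs only (Tao 2016 §4, self-similar variables of §6.4; cell vocabulary `IsEternalVisc`,
`UniformBound`, `EternalSurvivingFwd`, `InTableClass`); nothing here is a statement about the Navier–Stokes
equations; no stub, crux, rung or summit is proved (`--supports stmt-NavierStokesRegularity-20419`).

HYPOTHESIS AUDIT (tightness lemma, genre of the disprover's `_false_without_<H>` theorems).  The viscous
Liouville predicate `NoSurvivingEternalViscBdd R 1` quantifies over `IsEternalVisc ε₀ ν̂ α W`, whose field
`nonneg : 0 ≤ ν̂` is the only clause that mentions the SIGN of the covariant viscosity.  Delete it and the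
statement is false at every `ε₀ > 0` on every class `E₂(R)`, by a closed-form witness on the ZERO table
(`0 ∈ E₂(R)`: comparability allows vanishing structure constants, `inTableClass_zeroTable`): with `ν̂ = -1`
the shells decouple into `w' = -(1 - (1+ε₀)^{2n} e^{-σ}) w`, solved by

  `W_n(σ) = k_n e^{-σ} exp(-k_n e^{-σ}) · e₀`,   `k_n = (1+ε₀)^{2n}`,

which is the σ-derivative of `exp(-k_n e^{-σ}) ∈ (0,1)`; hence EVERY other clause holds with explicit
constants — law (`hasDerivAt_profile`), per-shell action `∫_ℝ ‖W_n‖ = 1` (`integral_profile`), forward bound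
`e^{2σ}‖W_n‖² = k_n² exp(-2k_n e^{-σ}) ≤ k_n²`, `UniformBound` with constant `1` (`x e^{-x} ≤ 1`) — and the
a=1-weighted energy is `p_n(σ) = exp(-2 k_n e^{-σ}) → 1`, so `W` is forward (S_a)-surviving for every
`a ≥ 1` (level `e^{-2}` at `a = 1`, `weighted_energy_ge`) and LOUD on every shell in the sense of `NoLoudLadder`
(`sup_σ p_n ≥ e^{-2} > 1/4096 = ν̂²/4096`, `exp_neg_two_gt`): `noSurvivingEternalViscBdd_false_without_nonneg`.
For `ν̂ ≥ 0` the same decoupled profiles `c e^{-σ} exp(+ν̂ k_n e^{-σ})` violate the action clause, consistent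
with the tree (`eternal_trivial_of_peelable` covers the zero table).  READING for the census of ⟨20419⟩/⟨20452⟩:
the case split `ν̂ = 0` (ρ0) / `ν̂ > 0` (seeded slice + ρ+) of `noSurvivingEternalViscBddOne_of` is exhaustive
ONLY through `nonneg`, and in (ρ+) the hypothesis `0 < ν̂` cannot be weakened to `ν̂ ≠ 0`: the anti-dissipative
regime carries bounded loud survivors on every class `E₂(R)` at every scale ratio.  The inviscid child (ρ0) is
untouched (`ν̂ = 0`).  HONEST LABEL: a remark on the hypothesis set with a one-line ODE; (ρ0), (ρ+), ⟨20419⟩ and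
every NS statement remain OPEN.
-/

noncomputable section

-- the summit and its single sub-problem share the name (CONVENTIONS §1)
set_option linter.dupNamespace false

namespace Summit.NavierStokesRegularity.NavierStokesRegularity.Theorems.NoSurvivingEternalViscBddOne.NonnegTightness

open Set Filter Topology MeasureTheory
open Literature.Analysis.FluidPDE Literature.Analysis.FluidPDE.TaoCascade

/-! ## §1 The scalar profile `w_k(σ) = k e^{-σ} exp(-k e^{-σ})` and its primitive `exp(-k e^{-σ})` -/

/-- `d/dσ exp(-k e^{-σ}) = k e^{-σ} exp(-k e^{-σ})`. [elementary] -/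
theorem hasDerivAt_prim (k σ : ℝ) :
    HasDerivAt (fun x => Real.exp (-(k * Real.exp (-x))))
      (k * Real.exp (-σ) * Real.exp (-(k * Real.exp (-σ)))) σ := by
  have h2 : HasDerivAt (fun x => Real.exp (-x)) (Real.exp (-σ) * (-1)) σ :=
    ((hasDerivAt_id σ).neg).exp
  have h3 : HasDerivAt (fun x => -(k * Real.exp (-x))) (-(k * (Real.exp (-σ) * (-1)))) σ :=
    (h2.const_mul k).neg
  have h4 : HasDerivAt (fun x => Real.exp (-(k * Real.exp (-x))))
      (Real.exp (-(k * Real.exp (-σ))) * (-(k * (Real.exp (-σ) * (-1))))) σ := h3.exp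
  convert h4 using 1
  ring

/-- `d/dσ w = -w + k e^{-σ} w` for `w(σ) = k e^{-σ} exp(-k e^{-σ})` — the decoupled shell law with
anti-dissipation `-ν̂ k e^{-σ} w`, `ν̂ = -1`. [elementary] -/
theorem hasDerivAt_profile (k σ : ℝ) :
    HasDerivAt (fun x => k * Real.exp (-x) * Real.exp (-(k * Real.exp (-x))))
      (-(k * Real.exp (-σ) * Real.exp (-(k * Real.exp (-σ))))
        + k * Real.exp (-σ) * (k * Real.exp (-σ) * Real.exp (-(k * Real.exp (-σ))))) σ := by
  have h2 : HasDerivAt (fun x => k * Real.exp (-x)) (k * (Real.exp (-σ) * (-1))) σ :=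
    (((hasDerivAt_id σ).neg).exp).const_mul k
  have h : HasDerivAt (fun x => k * Real.exp (-x) * Real.exp (-(k * Real.exp (-x))))
      (k * (Real.exp (-σ) * (-1)) * Real.exp (-(k * Real.exp (-σ)))
        + k * Real.exp (-σ) * (k * Real.exp (-σ) * Real.exp (-(k * Real.exp (-σ))))) σ :=
    h2.mul (hasDerivAt_prim k σ)
  exact h.congr_deriv (by ring)

/-- `0 ≤ w`. [elementary] -/
theorem profile_nonneg {k : ℝ} (hk : 0 ≤ k) (σ : ℝ) :
    0 ≤ k * Real.exp (-σ) * Real.exp (-(k * Real.exp (-σ))) := by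
  positivity

/-- `w ≤ 1` (`x e^{-x} ≤ 1`). [elementary] -/
theorem profile_le_one {k : ℝ} (hk : 0 ≤ k) (σ : ℝ) :
    k * Real.exp (-σ) * Real.exp (-(k * Real.exp (-σ))) ≤ 1 := by
  set x := k * Real.exp (-σ) with hx
  have hx0 : 0 ≤ x := by positivity
  have h1 : x + 1 ≤ Real.exp x := Real.add_one_le_exp x
  have hpos : 0 < Real.exp x := Real.exp_pos x
  rw [Real.exp_neg, mul_inv_le_iff₀ hpos]
  linarith

/-- The primitive is `≤ 1`. [elementary] -/
theorem prim_le_one {k : ℝ} (hk : 0 ≤ k) (σ : ℝ) : Real.exp (-(k * Real.exp (-σ))) ≤ 1 := by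
  rw [Real.exp_le_one_iff]
  have : 0 ≤ k * Real.exp (-σ) := by positivity
  linarith

/-- The primitive tends to `0` at `σ → -∞` (`k > 0`). [elementary] -/
theorem tendsto_prim_atBot {k : ℝ} (hk : 0 < k) :
    Tendsto (fun x => Real.exp (-(k * Real.exp (-x)))) atBot (𝓝 0) := by
  have h1 : Tendsto (fun x : ℝ => -x) atBot atTop := tendsto_neg_atBot_atTop
  have h2 : Tendsto (fun x : ℝ => Real.exp (-x)) atBot atTop := Real.tendsto_exp_atTop.comp h1
  have h3 : Tendsto (fun x : ℝ => k * Real.exp (-x)) atBot atTop := h2.const_mul_atTop hk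
  have h4 : Tendsto (fun x : ℝ => -(k * Real.exp (-x))) atBot atBot := tendsto_neg_atTop_atBot.comp h3
  exact Real.tendsto_exp_atBot.comp h4

/-- The primitive tends to `1` at `σ → +∞`. [elementary] -/
theorem tendsto_prim_atTop (k : ℝ) :
    Tendsto (fun x => Real.exp (-(k * Real.exp (-x)))) atTop (𝓝 1) := by
  have h2 : Tendsto (fun x : ℝ => Real.exp (-x)) atTop (𝓝 0) := Real.tendsto_exp_neg_atTop_nhds_zero
  have h3 : Tendsto (fun x : ℝ => -(k * Real.exp (-x))) atTop (𝓝 (-(k * 0))) := (h2.const_mul k).neg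
  have h4 := (Real.continuous_exp.tendsto _).comp h3
  simpa [Function.comp_def] using h4

/-- `w` is continuous. [elementary] -/
theorem continuous_profile (k : ℝ) :
    Continuous (fun x => k * Real.exp (-x) * Real.exp (-(k * Real.exp (-x)))) := by
  fun_prop

/-- `w` is integrable on `ℝ` (`∫_{-i}^{i} w = exp(-k e^{-i}) - exp(-k e^{i}) ≤ 1` for every `i`). [elementary] -/
theorem integrable_profile {k : ℝ} (hk : 0 < k) :
    Integrable (fun x => k * Real.exp (-x) * Real.exp (-(k * Real.exp (-x)))) := by
  have hcont := continuous_profile k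
  refine integrable_of_intervalIntegral_norm_bounded (μ := volume) (l := atTop) (1 : ℝ)
    (a := fun i : ℕ => -(i : ℝ)) (b := fun i : ℕ => (i : ℝ)) ?_ ?_ ?_ ?_
  · intro i
    exact hcont.integrableOn_Ioc
  · exact tendsto_neg_atTop_atBot.comp tendsto_natCast_atTop_atTop
  · exact tendsto_natCast_atTop_atTop
  · filter_upwards with i
    have heq : ∫ x in (-(i : ℝ))..(i : ℝ), ‖k * Real.exp (-x) * Real.exp (-(k * Real.exp (-x)))‖
        = ∫ x in (-(i : ℝ))..(i : ℝ), k * Real.exp (-x) * Real.exp (-(k * Real.exp (-x))) := by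
      refine intervalIntegral.integral_congr fun x _ => ?_
      simp only [Real.norm_eq_abs]
      exact abs_of_nonneg (profile_nonneg hk.le x)
    rw [heq, intervalIntegral.integral_eq_sub_of_hasDerivAt (fun x _ => hasDerivAt_prim k x)
      (hcont.intervalIntegrable _ _)]
    have h1 := prim_le_one hk.le (i : ℝ)
    have h2 : 0 ≤ Real.exp (-(k * Real.exp (-(-(i : ℝ))))) := (Real.exp_pos _).le
    linarith

/-- `∫_ℝ w = 1`. [elementary] -/
theorem integral_profile {k : ℝ} (hk : 0 < k) :
    ∫ x, k * Real.exp (-x) * Real.exp (-(k * Real.exp (-x))) = 1 := by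
  have h := integral_of_hasDerivAt_of_tendsto (fun x => hasDerivAt_prim k x) (integrable_profile hk)
    (tendsto_prim_atBot hk) (tendsto_prim_atTop k)
  rw [h]
  norm_num

/-! ## §2 The zero table lies in every class `E₂(R)` and has vanishing structure maps -/

/-- The zero table is symmetric, cancelling and `R`-comparable for every `R` (comparability allows vanishing
structure constants). [cite: Tao2016AveragedNS, §4 (4.2)–(4.3), §6.1; cell vocabulary `InTableClass`] -/
theorem inTableClass_zeroTable (R : ℝ) :
    InTableClass R (0 : Fin 4 → Fin 4 → Fin 4 → ℤ × ℤ × ℤ → ℝ) := by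
  refine ⟨?_, ?_, ?_⟩
  · intro i₁ i₂ i₃ μ₁ μ₂ μ₃ _; simp
  · intro i₁ i₂ i₃ μ₁ μ₂ μ₃ _; simp
  · intro i₁ i₂ i₃ μ _; simp

/-- The zero table has no intra-shell field. [cite: Tao2016AveragedNS, §4 (4.1), Lemma 4.1 (4.8); cell vocabulary `tableQ`] -/
theorem tableQ_zeroTable {m : ℕ} (x : Em m) :
    tableQ (0 : Fin m → Fin m → Fin m → ℤ × ℤ × ℤ → ℝ) x = 0 := by
  simp [tableQ, qform]

/-- The zero table has no outflow. [cite: Tao2016AveragedNS, §4 (4.1), Lemma 4.1 (4.8); cell vocabulary `tableA`] -/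
theorem tableA_zeroTable {m : ℕ} (x : Em m) :
    tableA (0 : Fin m → Fin m → Fin m → ℤ × ℤ × ℤ → ℝ) x = 0 := by
  simp [tableA, qform]

/-- The zero table has no back-reaction. [cite: Tao2016AveragedNS, §4 (4.1), Lemma 4.1 (4.8); cell vocabulary `tableB`] -/
theorem tableB_zeroTable {m : ℕ} (y x : Em m) :
    tableB (0 : Fin m → Fin m → Fin m → ℤ × ℤ × ℤ → ℝ) y x = 0 := by
  simp [tableB, qform]

/-! ## §3 The witness family `W_n(σ) = k_n e^{-σ} exp(-k_n e^{-σ}) · e₀`, `k_n = (1+ε₀)^{2n}` -/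

/-- Norm of a multiple of the unit vector `e₀`. [elementary] -/
theorem norm_smul_single (c : ℝ) : ‖c • EuclideanSpace.single (0 : Fin 4) (1 : ℝ)‖ = |c| := by
  rw [norm_smul, Real.norm_eq_abs]
  simp

/-- The renormalised energy of the witness shell: `e^{2σ}‖W_n(σ)‖² = k² exp(-k e^{-σ})²`. [elementary] -/
theorem energy_eq (k σ : ℝ) :
    Real.exp (2 * σ) * ‖(k * Real.exp (-σ) * Real.exp (-(k * Real.exp (-σ)))) •
        EuclideanSpace.single (0 : Fin 4) (1 : ℝ)‖ ^ 2
      = k ^ 2 * Real.exp (-(k * Real.exp (-σ))) ^ 2 := by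
  rw [norm_smul_single, sq_abs]
  have he : Real.exp (2 * σ) * Real.exp (-σ) ^ 2 = 1 := by
    rw [sq, ← Real.exp_add, ← Real.exp_add, show 2 * σ + (-σ + -σ) = 0 by ring, Real.exp_zero]
  calc Real.exp (2 * σ) * (k * Real.exp (-σ) * Real.exp (-(k * Real.exp (-σ)))) ^ 2
      = (Real.exp (2 * σ) * Real.exp (-σ) ^ 2) * (k ^ 2 * Real.exp (-(k * Real.exp (-σ))) ^ 2) := by ring
    _ = k ^ 2 * Real.exp (-(k * Real.exp (-σ))) ^ 2 := by rw [he, one_mul]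

/-- The a=1 weight cancels the clock factor: `physWeight(1)^N · ((1+ε₀)^{2N})² = 1`.
[cite: Tao2016AveragedNS, §4 (4.1), §6.4; cell vocabulary `physWeight`] -/
theorem weight_cancel {ε₀ : ℝ} (hε : 0 < ε₀) (N : ℕ) :
    physWeight 1 ε₀ ^ N * ((1 + ε₀) ^ ((2 : ℝ) * (((N : ℤ) : ℝ))) ) ^ 2 = 1 := by
  have hb : (0 : ℝ) < 1 + ε₀ := by linarith
  have hk : (1 + ε₀) ^ ((2 : ℝ) * (((N : ℤ) : ℝ))) = (1 + ε₀) ^ (2 * N) := by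
    rw [Int.cast_natCast, show (2 : ℝ) * (N : ℝ) = ((2 * N : ℕ) : ℝ) by push_cast; ring, Real.rpow_natCast]
  have h1 : physWeight 1 ε₀ = ((1 + ε₀) ^ (4 : ℕ))⁻¹ := by
    unfold physWeight
    rw [Real.rpow_one]
    field_simp
  rw [h1, hk, inv_pow, ← pow_mul, ← pow_mul, show 2 * N * 2 = 4 * N by ring]
  exact inv_mul_cancel₀ (pow_ne_zero _ hb.ne')

/-- `e^{-2} > 1/4096` (the witness' late weighted energy beats the dissipation-critical level `ν̂²/4096`, `ν̂ = -1`).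
[elementary] -/
theorem exp_neg_two_gt : (1 : ℝ) / 4096 < Real.exp (-2) := by
  have h1 : Real.exp 1 < 2.7182818286 := Real.exp_one_lt_d9
  have h0 : 0 < Real.exp 1 := Real.exp_pos 1
  have h2 : Real.exp 2 = Real.exp 1 * Real.exp 1 := by rw [← Real.exp_add]; norm_num
  have h3 : Real.exp 2 < 4096 := by rw [h2]; nlinarith
  rw [Real.exp_neg, one_div]
  exact inv_strictAnti₀ (Real.exp_pos 2) h3

/-- The a=1-weighted energy of the witness shell `N` is `≥ e^{-2}` at every log-time `σ ≥ log k_N`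
(`p_N(σ) = exp(-k_N e^{-σ})²`, `k_N e^{-σ} ≤ 1`).
[cite: Tao2016AveragedNS, §4 (4.1), §6.4; cell vocabulary `physWeight`] -/
theorem weighted_energy_ge {ε₀ : ℝ} (hε : 0 < ε₀) (N : ℕ) {σ : ℝ}
    (hσ : Real.log ((1 + ε₀) ^ ((2 : ℝ) * (((N : ℤ) : ℝ)))) ≤ σ) :
    Real.exp (-2) ≤ physWeight 1 ε₀ ^ N * (Real.exp (2 * σ) *
      ‖((1 + ε₀) ^ ((2 : ℝ) * (((N : ℤ) : ℝ))) * Real.exp (-σ) *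
          Real.exp (-((1 + ε₀) ^ ((2 : ℝ) * (((N : ℤ) : ℝ))) * Real.exp (-σ)))) •
        EuclideanSpace.single (0 : Fin 4) (1 : ℝ)‖ ^ 2) := by
  have hb : (0 : ℝ) < 1 + ε₀ := by linarith
  set k : ℝ := (1 + ε₀) ^ ((2 : ℝ) * (((N : ℤ) : ℝ))) with hk_def
  have hk : 0 < k := Real.rpow_pos_of_pos hb _
  rw [energy_eq, ← mul_assoc, hk_def, weight_cancel hε N, one_mul, ← hk_def]
  -- `k e^{-σ} ≤ 1`
  have hx : k * Real.exp (-σ) ≤ 1 := by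
    have h1 : Real.exp (-σ) ≤ Real.exp (-Real.log k) := Real.exp_le_exp.mpr (neg_le_neg hσ)
    rw [Real.exp_neg (Real.log k), Real.exp_log hk] at h1
    calc k * Real.exp (-σ) ≤ k * k⁻¹ := mul_le_mul_of_nonneg_left h1 hk.le
      _ = 1 := mul_inv_cancel₀ hk.ne'
  have h2 : Real.exp (-1) ≤ Real.exp (-(k * Real.exp (-σ))) := Real.exp_le_exp.mpr (by linarith)
  have h3 : Real.exp (-2) = Real.exp (-1) ^ 2 := by
    rw [sq, ← Real.exp_add]; norm_num
  rw [h3]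
  exact pow_le_pow_left₀ (Real.exp_pos _).le h2 2

/-- **THE SIGN CONDITION `0 ≤ ν̂` IS LOAD-BEARING.**  For every spread `R` and EVERY `ε₀ > 0` there are a
table of `E₂(R)` (the zero table), a NEGATIVE covariant viscosity (`ν̂ = -1`) and a family `W : ℤ → ℝ → ℝ⁴`
satisfying every clause of `IsEternalVisc ε₀ ν̂ α W` except `nonneg` — the shell-wise law with covariant
(anti-)viscosity, the uniform per-shell action bound (`∫_ℝ ‖W_n‖ = 1`), the per-shell forward bound — which is
moreover UNIFORMLY BOUNDED (constant `1`), non-zero, LOUD ON EVERY SHELL in the sense of `NoLoudLadder` (each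
a=1-weighted shell energy exceeds `ν̂²/4096`) and FORWARD (S_a)-SURVIVING for every exponent `a ≥ 1` (level
`e^{-2}` at `a = 1`): the conclusions of `NoSurvivingEternalViscBdd R 1` and of `NoLoudLadder R` fail for it.  So
the case split `ν̂ = 0` (ρ0) / `ν̂ > 0` (seeded slice, ρ+) behind `noSurvivingEternalViscBddOne_of` is exhaustive
ONLY through `nonneg`, and in (ρ+) the hypothesis `0 < ν̂` cannot be weakened to `ν̂ ≠ 0`.
Witness: `W_n(σ) = k_n e^{-σ}exp(-k_n e^{-σ})·e₀`, `k_n = (1+ε₀)^{2n}`.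
[cite: Tao2016AveragedNS, §4, the viscous equation before Thm. 4.2 in the self-similar variables of §6.4; cell vocabulary `IsEternalVisc`, `UniformBound`, `EternalSurvivingFwd`, `wtEnergy`, `NoLoudLadder`] -/
theorem noSurvivingEternalViscBdd_false_without_nonneg (R ε₀ : ℝ) (hε : 0 < ε₀) :
    ∃ (α : Fin 4 → Fin 4 → Fin 4 → ℤ × ℤ × ℤ → ℝ) (νh : ℝ) (W : ℤ → ℝ → Em 4),
      InTableClass R α ∧ νh < 0 ∧
      (∀ (n : ℤ) (σ : ℝ), HasDerivAt (W n)
        (-((1 : ℝ) • W n σ) + tableQ α (W n σ) + bigLam ε₀ • tableA α (W (n - 1) σ)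
          + (bigLam ε₀)⁻¹ • tableB α (W (n + 1) σ) (W n σ)
          - (νh * ((1 + ε₀) ^ ((2 : ℝ) * n) * Real.exp (-σ))) • W n σ) σ) ∧
      (∃ M : ℝ, ∀ n : ℤ, Integrable (fun σ => ‖W n σ‖) ∧ ∫ σ, ‖W n σ‖ ≤ M) ∧
      (∀ n : ℤ, ∃ σ₀ P : ℝ, ∀ σ, σ₀ ≤ σ → Real.exp (2 * σ) * ‖W n σ‖ ^ 2 ≤ P) ∧
      UniformBound W ∧
      (∀ n₀ : ℕ, ∀ s₀ : ℝ, s₀ < νh ^ 2 / 4096 → ∃ σ : ℝ, s₀ < wtEnergy ε₀ W n₀ σ) ∧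
      EternalSurvivingFwd 1 ε₀ W ∧ (∀ a : ℝ, 1 ≤ a → EternalSurvivingFwd a ε₀ W) ∧
      W 0 0 ≠ 0 := by
  have hb : (0 : ℝ) < 1 + ε₀ := by linarith
  -- the clock constants k_n = (1+ε₀)^{2n} > 0
  have hkpos : ∀ n : ℤ, (0 : ℝ) < (1 + ε₀) ^ ((2 : ℝ) * n) := fun n => Real.rpow_pos_of_pos hb _
  -- forward (S₁)-survival with level `e^{-2}` (used twice below)
  have hsurv : EternalSurvivingFwd 1 ε₀ (fun (n : ℤ) σ => ((1 + ε₀) ^ ((2 : ℝ) * n) * Real.exp (-σ) *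
      Real.exp (-((1 + ε₀) ^ ((2 : ℝ) * n) * Real.exp (-σ)))) • EuclideanSpace.single (0 : Fin 4) (1 : ℝ)) := by
    refine ⟨Real.exp (-2), Real.exp_pos _, fun N => ⟨N, le_rfl, ?_⟩⟩
    refine ⟨max (N : ℝ) (Real.log ((1 + ε₀) ^ ((2 : ℝ) * (((N : ℤ) : ℝ))))), le_max_left _ _, ?_⟩
    exact weighted_energy_ge hε N (le_max_right _ _)
  refine ⟨0, -1, fun n σ => ((1 + ε₀) ^ ((2 : ℝ) * n) * Real.exp (-σ) *
      Real.exp (-((1 + ε₀) ^ ((2 : ℝ) * n) * Real.exp (-σ)))) • EuclideanSpace.single (0 : Fin 4) (1 : ℝ),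
    inTableClass_zeroTable R, by norm_num, ?_, ?_, ?_, ?_, ?_, hsurv, ?_, ?_⟩
  · -- the law: decoupled shells, `w' = -w + k e^{-σ} w`
    intro n σ
    have h := (hasDerivAt_profile ((1 + ε₀) ^ ((2 : ℝ) * n)) σ).smul_const
      (EuclideanSpace.single (0 : Fin 4) (1 : ℝ))
    refine h.congr_deriv ?_
    rw [tableQ_zeroTable, tableA_zeroTable, tableB_zeroTable]
    module
  · -- uniform per-shell action: `∫_ℝ ‖W_n‖ = 1`
    refine ⟨1, fun n => ?_⟩
    have hfun : (fun σ => ‖((1 + ε₀) ^ ((2 : ℝ) * n) * Real.exp (-σ) *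
        Real.exp (-((1 + ε₀) ^ ((2 : ℝ) * n) * Real.exp (-σ)))) • EuclideanSpace.single (0 : Fin 4) (1 : ℝ)‖)
        = fun σ => (1 + ε₀) ^ ((2 : ℝ) * n) * Real.exp (-σ) *
            Real.exp (-((1 + ε₀) ^ ((2 : ℝ) * n) * Real.exp (-σ))) := by
      funext σ
      rw [norm_smul_single]
      exact abs_of_nonneg (profile_nonneg (hkpos n).le σ)
    refine ⟨?_, ?_⟩
    · rw [hfun]; exact integrable_profile (hkpos n)
    · rw [hfun, integral_profile (hkpos n)]
  · -- per-shell forward bound `e^{2σ}‖W_n‖² ≤ k_n²`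
    intro n
    refine ⟨0, ((1 + ε₀) ^ ((2 : ℝ) * n)) ^ 2, fun σ _ => ?_⟩
    rw [energy_eq]
    have h1 := prim_le_one (hkpos n).le σ
    have h0 : 0 ≤ Real.exp (-((1 + ε₀) ^ ((2 : ℝ) * n) * Real.exp (-σ))) := (Real.exp_pos _).le
    have h2 : Real.exp (-((1 + ε₀) ^ ((2 : ℝ) * n) * Real.exp (-σ))) ^ 2 ≤ 1 := by
      calc Real.exp (-((1 + ε₀) ^ ((2 : ℝ) * n) * Real.exp (-σ))) ^ 2 ≤ 1 ^ 2 :=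
            pow_le_pow_left₀ h0 h1 2
        _ = 1 := one_pow 2
    have hk2 : 0 ≤ ((1 + ε₀) ^ ((2 : ℝ) * n)) ^ 2 := sq_nonneg _
    calc ((1 + ε₀) ^ ((2 : ℝ) * n)) ^ 2 * Real.exp (-((1 + ε₀) ^ ((2 : ℝ) * n) * Real.exp (-σ))) ^ 2
        ≤ ((1 + ε₀) ^ ((2 : ℝ) * n)) ^ 2 * 1 := mul_le_mul_of_nonneg_left h2 hk2
      _ = ((1 + ε₀) ^ ((2 : ℝ) * n)) ^ 2 := mul_one _
  · -- uniform bound `‖W_n(σ)‖ ≤ 1`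
    refine ⟨1, fun n σ => ?_⟩
    show ‖((1 + ε₀) ^ ((2 : ℝ) * n) * Real.exp (-σ) *
        Real.exp (-((1 + ε₀) ^ ((2 : ℝ) * n) * Real.exp (-σ)))) • EuclideanSpace.single (0 : Fin 4) (1 : ℝ)‖ ≤ 1
    rw [norm_smul_single, abs_of_nonneg (profile_nonneg (hkpos n).le σ)]
    exact profile_le_one (hkpos n).le σ
  · -- loud on every shell: `sup_σ p_{n₀} ≥ e^{-2} > 1/4096 = ν̂²/4096`
    intro n₀ s₀ hs₀
    refine ⟨Real.log ((1 + ε₀) ^ ((2 : ℝ) * (((n₀ : ℤ) : ℝ)))), ?_⟩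
    have h1 := weighted_energy_ge hε n₀ (le_refl (Real.log ((1 + ε₀) ^ ((2 : ℝ) * (((n₀ : ℤ) : ℝ))))))
    have h2 : s₀ < Real.exp (-2) := by
      have : (-1 : ℝ) ^ 2 / 4096 = 1 / 4096 := by norm_num
      rw [this] at hs₀
      exact hs₀.trans exp_neg_two_gt
    exact h2.trans_le h1
  · -- every exponent `a ≥ 1`
    intro a ha
    exact hsurv.mono hε.le ha
  · -- non-zero: `W_0(0) = e^{-1} · e₀`
    intro h
    simpa using congrArg (fun v : Em 4 => v 0) h

end Summit.NavierStokesRegularity.NavierStokesRegularity.Theorems.NoSurvivingEternalViscBddOne.NonnegTightness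

end
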